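import Literature.NumberTheory.LFunctions.Zhang2022.RepairAdmissibleWide

/-!
# Zhang (2022) §18-margin repair rung, barrier extension (slice S-E-p5-1, addendum): the verdict needs
# the LENGTHS only — every shift `k₁, k₂, k₃ ∈ ℝ` (untwisted pieces `k = 0` included)

Trunk T-ANT (NumberTheory/LFunctions). Y. Zhang, *Discrete mean estimates and the Landau–Siegel
zero*, arXiv:2211.02515v1 (2022) [Zhang2022LandauSiegel] — **an unrefereed manuscript under
adjudication. WHAT THIS IS NOT: a claim about its Theorems 1–2, about Landau–Siegel zeros, about
Parity, or about a repaired `Margin232`. The programme SEARCHES and TYPES; no claim about Landau–Siegel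
zeros, Theorems 1–2 of arXiv:2211.02515 or a repaired Margin232 until a kernel theorem says so.**

`RepairAdmissibleWide` re-ran the dictionary on `AdmissibleThetaCalc` (`0 < ν₃ ≤ ν₂ < ν₁ ≤ 1`,
`k₁ k₂ k₃ ≠ 0`). The three conditions `k_j ≠ 0` are consumed ONLY by the closed-form display
`C232S = Re 𝔠₁T + Re 𝔠₂T + 2Re 𝔠₃ˢ` (`pairForm_eq_mainTermForm`: the printed closed forms (8.23)/(9.7)
divide by `k`), never by the verdict chain itself (`kinkedProfile_kappaP` has no shift hypothesis; the
profile `ϰ_{ν,0}(y) = 1 − y/ν` is the UNTWISTED linear piece). This addendum records that the kernel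
accepts the verdict on the lengths alone:

* `Theta.lengthsInUnit θ := 0 < ν₃ ≤ ν₂ < ν₁ ≤ 1` (every `k_j ∈ ℝ`, `ι ∈ ℂ³`, `cut₁` free);
  `AdmissibleThetaCalc.lengthsInUnit` (so `R ⊆ R_wide ⊆ R_calc ⊆ R_len`);
* the five dictionary hypotheses on `R_len`: `glued_isH1_of_lengths`, `tent_isH1_of_lengths`,
  `h232_of_lengths`, `h233_of_lengths`, `hsum_of_lengths`;
* **`not_repairable_true_need_of_lengths : ∀ θ, θ.lengthsInUnit → ¬ (C232S θ * C233T θ < ‖dSumS θ‖ ^ 2)`**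
  and the Cauchy–Schwarz inequality `normSq_dSumS_le_of_lengths`;
* strictness witness `thetaUntwisted` (`θ₀` with `k₃ = 0`: `H₁₃` untwisted; in `R_len \ R_calc`);
* `familyRLengths`, `familyRLengths_decided` (extension protocol of `RepairRplus`).

Currency as in `RepairAdmissibleWide`: continued-calculus constants; off `R` the identification with
the (A)-world main terms is registry item E-017 (open) — for an untwisted piece additionally the
arithmetic-class lever L16 of the cell's LEVERS file (closed at support `≤ 1` by the same dictionary
type; no range wall). No certificate consumed.

Reference: Y. Zhang, arXiv:2211.02515v1 (2022), §2 (2.21)–(2.28), Props. 2.4–2.6, (2.32)–(2.33);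
§10 (10.1), (10.12)–(10.19). [cite: Zhang2022LandauSiegel, §§2, 10]
-/

noncomputable section

open Real Complex ComplexConjugate MeasureTheory Set
open scoped Interval

namespace Literature.NumberTheory.LFunctions.Zhang2022

namespace Repair

variable {θ : Theta}

/-- **The lengths-only class `R_len`**: `0 < ν₃ ≤ ν₂ < ν₁ ≤ 1`; shifts `k_j ∈ ℝ` arbitrary (the
untwisted pieces `k = 0` included), `ι ∈ ℂ³` and `cut₁` free. [cite: Zhang2022LandauSiegel, §2 (2.21)–(2.28)] -/
def Theta.lengthsInUnit (θ : Theta) : Prop :=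
  0 < θ.nu3 ∧ θ.nu3 ≤ θ.nu2 ∧ θ.nu2 < θ.nu1 ∧ θ.nu1 ≤ 1

/-- `R_calc ⊆ R_len` (forget the three shift conditions). [cite: Zhang2022LandauSiegel, §2 (2.21)–(2.28)] -/
theorem AdmissibleThetaCalc.lengthsInUnit (h : AdmissibleThetaCalc θ) : θ.lengthsInUnit :=
  ⟨h.1, h.2.1, h.2.2.1, h.2.2.2.1⟩

/-- `R_wide ⊆ R_len`. [cite: Zhang2022LandauSiegel, §2 (2.21)–(2.28)] -/
theorem AdmissibleThetaWide.lengthsInUnit (h : AdmissibleThetaWide θ) : θ.lengthsInUnit :=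
  h.toCalc.lengthsInUnit

/-- `R ⊆ R_len`. [cite: Zhang2022LandauSiegel, §2 (2.21)–(2.28)] -/
theorem AdmissibleTheta.lengthsInUnit (h : AdmissibleTheta θ) : θ.lengthsInUnit :=
  h.toCalc.lengthsInUnit

/-! ### Strictness witness: an untwisted piece -/

/-- The printed design `θ₀` with `k₃ = 0` (`H₁₃` untwisted: profile `ϰ_{ν₃,0}(y) = 1 − y/ν₃`).
[cite: Zhang2022LandauSiegel, §2 (2.21)–(2.26)] -/
def thetaUntwisted : Theta where
  nu1 := 0.504
  nu2 := 0.5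
  nu3 := 0.498
  k1 := 3 / 2
  k2 := 5 / 2
  k3 := 0
  iota2 := iota2
  iota3 := iota3
  iota4 := iota4
  cut1 := 0.5

/-- `thetaUntwisted ∈ R_len`. [cite: Zhang2022LandauSiegel, §2 (2.21)–(2.26)] -/
theorem lengthsInUnit_thetaUntwisted : thetaUntwisted.lengthsInUnit := by
  unfold Theta.lengthsInUnit thetaUntwisted; norm_num

/-- `thetaUntwisted ∉ R_calc` (`k₃ = 0`): the widening is strict. [cite: Zhang2022LandauSiegel, §2 (2.22)–(2.25)] -/
theorem not_admissibleCalc_thetaUntwisted : ¬ AdmissibleThetaCalc thetaUntwisted := by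
  rintro ⟨-, -, -, -, -, -, hk3⟩
  exact hk3 rfl

/-! ### The five dictionary hypotheses on the lengths-only class -/

/-- `H₁`'s profile is a kinked `H¹` profile on `R_len` (any `k₁, k₂`). [cite: Zhang2022LandauSiegel, (2.23), (2.24), (2.27)] -/
theorem kinkedProfile_h1Profile_of_lengths (h : θ.lengthsInUnit) :
    KinkedProfile (h1Profile θ) (h1Profile' θ) := by
  obtain ⟨h3, h32, h21, h1⟩ := h
  exact kinkedProfile_pairProfile (h3.trans_le h32) h21.le h1 1 θ.iota2

/-- `H₂`'s profile is a kinked `H¹` profile on `R_len` (any `k₂, k₃`). [cite: Zhang2022LandauSiegel, (2.24), (2.25), (2.27)] -/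
theorem kinkedProfile_h2Profile_of_lengths (h : θ.lengthsInUnit) :
    KinkedProfile (h2Profile θ) (h2Profile' θ) := by
  obtain ⟨h3, h32, h21, h1⟩ := h
  exact kinkedProfile_pairProfile h3 h32 (h21.le.trans h1) (conj θ.iota4) (conj θ.iota3)

/-- `hgl` on `R_len`. [cite: Zhang2022LandauSiegel, §2 (2.27), (2.32)] -/
theorem glued_isH1_of_lengths : ∀ θ : Theta, θ.lengthsInUnit → IsH1OnUnitInterval (gluedS θ) (gluedS' θ) :=
  fun _ h => (kinkedProfile_h1Profile_of_lengths h).isH1.add_refl (kinkedProfile_h2Profile_of_lengths h).isH1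

/-- `hfp` on `R_len`. [cite: Zhang2022LandauSiegel, §2 (2.28)] -/
theorem tent_isH1_of_lengths : ∀ θ : Theta, θ.lengthsInUnit → IsH1OnUnitInterval (tentT θ) (tentT' θ) :=
  fun _ h => isH1_tentT h.2.2.1

/-- `h232` on `R_len` (definitional). [cite: Zhang2022LandauSiegel, §18 (18.1), (2.32)] -/
theorem h232_of_lengths : ∀ θ : Theta, θ.lengthsInUnit → C232S θ = mainTermForm (gluedS θ) (gluedS' θ) :=
  fun θ _ => C232S_eq_form θ

/-- `h233` on `R_len`. [cite: Zhang2022LandauSiegel, §10 (10.19), (2.33)] -/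
theorem h233_of_lengths : ∀ θ : Theta, θ.lengthsInUnit → C233T θ = mainTermForm (tentT θ) (tentT' θ) := by
  intro θ h
  obtain ⟨h3, h32, h21, h1⟩ := h
  exact (mainTermForm_tentT_eq_C233T h21 (by linarith) h1).symm

/-- K-S3 `𝔡`-block on `R_len`. [cite: Zhang2022LandauSiegel, §10 (10.1), (10.12)–(10.13)] -/
theorem dSum1S_eq_polar_of_lengths (h : θ.lengthsInUnit) :
    dSum1S θ = mainTermFormPolar (h1Profile θ) (h1Profile' θ) (tentT θ) (tentT' θ) := by
  have hg := kinkedProfile_h1Profile_of_lengths h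
  obtain ⟨h3, h32, h21, h1⟩ := h
  have hf := kinkedProfile_tentT h21
  have hg1 : h1Profile θ 1 = 0 := by
    unfold h1Profile pairProfile
    rw [kappaP_one (by linarith) h1, kappaP_one (by linarith) (h21.le.trans h1)]; ring
  have hf1 : tentT θ 1 = 0 := tentT_of_hi_le h21 h1
  rw [mainTermFormPolar_eq_Mform hg hf hg1 hf1]; rfl

/-- K-S3 reflected-tent block on `R_len`. [cite: Zhang2022LandauSiegel, §10 (10.1), (10.14)–(10.16)] -/
theorem polar_rtent_h2_eq_of_lengths (h : θ.lengthsInUnit) :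
    mainTermFormPolar (tentT θ.reflectJ) (tentT' θ.reflectJ) (h2Profile θ) (h2Profile' θ) = dSum2S θ := by
  have hg := kinkedProfile_h2Profile_of_lengths h
  obtain ⟨h3, h32, h21, h1⟩ := h
  have hf := kinkedProfile_tentT (reflectJ_lt h21)
  have hg1 : h2Profile θ 1 = 0 := by
    unfold h2Profile pairProfile
    rw [kappaP_one (by linarith) (h21.le.trans h1), kappaP_one h3 (by linarith)]; ring
  have hf1 : tentT θ.reflectJ 1 = 0 :=
    tentT_of_hi_le (reflectJ_lt h21) (by simp only [reflectJ_nu1]; linarith)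
  rw [mainTermFormPolar_eq_Mform hf hg hf1 hg1]; rfl

/-- K-S3 `𝔡′`-block on `R_len`. [cite: Zhang2022LandauSiegel, §10 (10.1), (10.14)–(10.17)] -/
theorem dSum2S_eq_polar_of_lengths (h : θ.lengthsInUnit) :
    dSum2S θ = mainTermFormPolar (reflProfile (h2Profile θ)) (reflDeriv (h2Profile' θ))
      (tentT θ) (tentT' θ) := by
  have hgc : ContinuousOn (h2Profile θ) (Icc 0 1) := (kinkedProfile_h2Profile_of_lengths h).cont
  have hpol := polar_rtent_h2_eq_of_lengths h
  obtain ⟨h3, h32, h21, h1⟩ := h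
  have hfc : ContinuousOn (tentT θ.reflectJ) (Icc 0 1) := (continuous_tentT _).continuousOn
  have hrefl := mainTermFormPolar_refl hgc hfc (h2Profile' θ) (tentT' θ.reflectJ)
  rw [reflProfile_tentT_reflectJ] at hrefl
  have hae : ∀ᵐ x ∂volume, x ∈ Ι (0:ℝ) 1 → reflDeriv (tentT' θ.reflectJ) x = tentT' θ x := by
    have h' := reflDeriv_tentT'_ae (reflectJ_lt h21)
    rw [Theta.reflectJ_reflectJ] at h'; exact h'
  rw [mainTermFormPolar_congr_ae hae] at hrefl
  rw [hrefl, ← mainTermFormPolar_swap, hpol]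

/-- `hsum` on `R_len`. [cite: Zhang2022LandauSiegel, §2 (2.17)–(2.18); §10 (10.1), (10.17)] -/
theorem hsum_of_lengths : ∀ θ : Theta, θ.lengthsInUnit →
    dSumS θ = mainTermFormPolar (gluedS θ) (gluedS' θ) (tentT θ) (tentT' θ) := by
  intro θ h
  have k1 := kinkedProfile_h1Profile_of_lengths h
  have k2 := kinkedProfile_h2Profile_of_lengths h
  have e1 := dSum1S_eq_polar_of_lengths h
  have e2 := dSum2S_eq_polar_of_lengths h
  obtain ⟨-, -, h21, -⟩ := h
  show dSum1S θ + dSum2S θ =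
    mainTermFormPolar (fun y => h1Profile θ y + reflProfile (h2Profile θ) y)
      (fun y => h1Profile' θ y + reflDeriv (h2Profile' θ) y) (tentT θ) (tentT' θ)
  rw [polar_add_refl_left k1.isH1 k2.isH1 (isH1_tentT h21), e1, e2]

/-! ### The verdict on the lengths-only class -/

/-- **NOT-REPAIRABLE on `R_len`** (continued-calculus currency): for every design with
`0 < ν₃ ≤ ν₂ < ν₁ ≤ 1` — ANY shifts `k₁, k₂, k₃ ∈ ℝ` (untwisted pieces included), any `ι`, any `cut₁` —
`¬ (C₂₃₂(θ)·C₂₃₃(θ) < |𝔡+𝔡′|²(θ))`. Validity off `R`: registry item E-017 (open); untwisted pieces: lever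
L16 of the cell's LEVERS (same dictionary type). [cite: Zhang2022LandauSiegel, §2 Props. 2.4–2.6, (2.32)–(2.33)] -/
theorem not_repairable_true_need_of_lengths :
    ∀ θ : Theta, θ.lengthsInUnit → ¬ (C232S θ * C233T θ < ‖dSumS θ‖ ^ 2) :=
  not_trueNeed_of_domination glued_isH1_of_lengths tent_isH1_of_lengths
    (fun θ h => (h232_of_lengths θ h).symm.le) (fun θ h => (h233_of_lengths θ h).symm.le)
    (fun θ h => (hsum_of_lengths θ h).symm ▸ le_rfl)

/-- Cauchy–Schwarz on `R_len`: `|𝔡+𝔡′|²(θ) ≤ C₂₃₂(θ)·C₂₃₃(θ)`. [cite: Zhang2022LandauSiegel, §2 after (2.33)] -/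
theorem normSq_dSumS_le_of_lengths :
    ∀ θ : Theta, θ.lengthsInUnit → ‖dSumS θ‖ ^ 2 ≤ C232S θ * C233T θ :=
  normSq_dSum_le_of_domination glued_isH1_of_lengths tent_isH1_of_lengths
    (fun θ h => (h232_of_lengths θ h).symm.le) (fun θ h => (h233_of_lengths θ h).symm.le)
    (fun θ h => (hsum_of_lengths θ h).symm ▸ le_rfl)

/-- T-zero impossible on `R_len`: `0 ≤ C₂₃₂(θ)`. [cite: Zhang2022LandauSiegel, §2 Lemma 2.3, (2.32)] -/
theorem margin_nonneg_of_lengths : ∀ θ : Theta, θ.lengthsInUnit → 0 ≤ C232S θ :=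
  C232S_nonneg_of_domination glued_isH1_of_lengths (fun θ h => (h232_of_lengths θ h).symm.le)

/-- At the untwisted design the §2 endgame does not close at main order. [cite: Zhang2022LandauSiegel, §2 (2.32)–(2.33)] -/
theorem not_repairable_thetaUntwisted :
    ¬ (C232S thetaUntwisted * C233T thetaUntwisted < ‖dSumS thetaUntwisted‖ ^ 2) :=
  not_repairable_true_need_of_lengths _ lengthsInUnit_thetaUntwisted

/-! ### Extension protocol -/

/-- family `R_len` (T-true continued-calculus currency; nothing displayed). [cite: Zhang2022LandauSiegel, §2 (2.32)–(2.33)] -/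
def familyRLengths : DesignFamily where
  Design := Theta
  InClass θ := θ.lengthsInUnit
  Verdict θ := ¬ (C232S θ * C233T θ < ‖dSumS θ‖ ^ 2)

/-- `familyRLengths` is decided. [cite: Zhang2022LandauSiegel, §2 (2.32)–(2.33)] -/
theorem familyRLengths_decided : familyRLengths.Decided := not_repairable_true_need_of_lengths

/-- `familyRCalc`'s members are `familyRLengths`' members. [cite: Zhang2022LandauSiegel, §2 (2.32)–(2.33)] -/
theorem familyRCalc_inClass_lengths (θ : Theta) (h : familyRCalc.InClass θ) : familyRLengths.InClass θ :=
  AdmissibleThetaCalc.lengthsInUnit h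

/-- `R⁺ ++ [familyRWide, familyRLengths]` is decided. [cite: Zhang2022LandauSiegel, §2 (2.32)–(2.33)] -/
theorem rplus_wide_lengths_decided : ClassDecided (Rplus ++ [familyRWide, familyRLengths]) :=
  classDecided_append.2 ⟨rplus_decided,
    classDecided_cons familyRWide_decided (classDecided_cons familyRLengths_decided classDecided_nil)⟩

end Repair

end Literature.NumberTheory.LFunctions.Zhang2022
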